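import Summits.CriticalPhenomena.PercolationContinuityZ3.Theorems.PercNearOneGluingNoHeavyLowerTailHullPortCSHFourPT
import Summits.CriticalPhenomena.PercolationContinuityZ3.Theorems.PercNearOneGluingNoHeavyLowerTailHullPortCSHUnfoldOne
import Summits.CriticalPhenomena.PercolationContinuityZ3.Theorems.PercNearOneGluingNoHeavyLowerTailCovTauOfTA
import HarnessLib

/-!
# `NoHeavyLowerTail` (stmt-CriticalPhenomena-4575) — conditioned slack hierarchy: the level-one cell

Support file (prover `prim-ineq-prove-5`; `--supports stmt-CriticalPhenomena-4575`); no definitions, named facts or sorries.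
prim-hp-8's Theorem 1 (memo run/shared/lean/prim/prim-hp-8/PROOF-S5-ALL-R.md §3, socket SOCKET-CSH-LEAN.md) at level `k = 1`:
CSH(`Y; x; (d); o, v`)[Ψ] — `Cov_ν(Ψ(C_x), 1_o − c_o1_d − p(1_v − c_v1_d)) ≥ 0`, `ν = μ(· | x ↮ Y)`, `c_u = μ(u∈C_d | d↮x,Y)`,
`p = μ(o∈C_v | v↮x,d,Y)` — for EVERY monotone `Ψ` of the open edge cluster of `x`, MODULO the diagonal A2/T_A inequality (Htw)
(hypothesis `HTW`, `delE` form; socket piece P4).  Assembly: Lemma T (`BHK2006_clusterConditionalCov_nonneg_of_within`) reduces to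
the within statement, which by Lemma U (`HullPort.lemmaU_one`) splits into the H-part (`HullPort.hpart_nonneg`: world set-4PT + Htw)
and the K-part (`HullPort.kpart_nonneg`: COV(τ) with avoided set `{x} ∪ Y` — `CovTau.markerDominanceAvoid` — applied to hp-8's
functional `Φ`, monotone by `HullPort.cshPhi_mono`).
[cite: VandenbergHaggstromKahn2005, §2.1 pp. 10–13, Thms. 1.3–1.5 — corollaries] [cite: Gladkov2024, Thm. 3.2 — via `CovTau.ta_nonneg`]
-/

noncomputable section

namespace Summit.CriticalPhenomena.PercolationContinuityZ3.Theorems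

open MeasureTheory Set Literature.Probability.LatticeModels Literature.Probability.Percolation
open scoped Classical

variable {V : Type*}

namespace HullPort

open LonePortSum LonePortSumGeneral BHK2006 DecisionTree KNPreFKG

section CSHCell

variable [Fintype V]

/-! ### The K-part: COV(τ) with avoided set `{x} ∪ Y` for the functional `Φ` (K5) -/

/-- `Σ_ω w 1_E Φ(C_d) (1{d↔u} − c) = ∫_{E ∩ {d↔u}} Φ(C_d) − c ∫_E Φ(C_d)`. [folklore] -/
theorem sum_ind_phi_eq (q : Sym2 V → unitInterval) (d u : V) (E : Set (BondConfig V)) (Φ : Set (Sym2 V) → ℝ) (c : ℝ) :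
    ∑ ω, weight (fun e => (q e : ℝ)) ω * (ind E ω * (Φ (openEdgeCluster ω d) * (ind (openConn d u : Set (BondConfig V)) ω - c))) =
      (∫ ω in E ∩ openConn d u, Φ (openEdgeCluster ω d) ∂(prodBernoulli q)) -
        c * ∫ ω in E, Φ (openEdgeCluster ω d) ∂(prodBernoulli q) := by
  rw [setIntegral_eq_sum, setIntegral_eq_sum, Finset.mul_sum, ← Finset.sum_sub_distrib]
  refine Finset.sum_congr rfl fun ω _ => ?_
  rw [ind_inter]; ring

/-- **The K-part is nonnegative** (prim-hp-8 §3.5 at k = 1: the decoy term is the margin of COV(τ) for owner `d`, avoided set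
`{x} ∪ Y`, functional `Φ`): with `p·μ(A) = μ(A ∩ {v↔o})`, `c_u·μ(E₁) = μ(E₁ ∩ {d↔u})`,
`0 ≤ Σ_ω w 1_{E₁}Φ(C_d)(1{d↔o} − c_o) − p Σ_ω w 1_{E₁}Φ(C_d)(1{d↔v} − c_v)`.
[cite: VandenbergHaggstromKahn2005, Thms. 1.3–1.4 (pp. 6–7), §2.1 (pp. 9–13) — via `CovTau.markerDominanceAvoid`] -/
theorem kpart_nonneg (q : Sym2 V → unitInterval) (hq : ∀ e, (q e : ℝ) < 1) (x d o v : V) (Y : Set V)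
    (hvd : v ≠ d) (hvx : v ≠ x) (hvY : v ∉ Y) (hdx : d ≠ x) (hdY : d ∉ Y)
    (g : Set (Sym2 V) → ℝ) (hg : Monotone g) (p co cv : ℝ)
    (hp : p * (prodBernoulli q).real {ω : BondConfig V | ∀ t ∈ insert d (insert x Y), ¬ (openGraph ω).Reachable v t} =
      (prodBernoulli q).real ({ω : BondConfig V | ∀ t ∈ insert d (insert x Y), ¬ (openGraph ω).Reachable v t} ∩ openConn v o))
    (hco : co * (prodBernoulli q).real {ω : BondConfig V | ∀ t ∈ insert x Y, ¬ (openGraph ω).Reachable d t} =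
      (prodBernoulli q).real ({ω : BondConfig V | ∀ t ∈ insert x Y, ¬ (openGraph ω).Reachable d t} ∩ openConn d o))
    (hcv : cv * (prodBernoulli q).real {ω : BondConfig V | ∀ t ∈ insert x Y, ¬ (openGraph ω).Reachable d t} =
      (prodBernoulli q).real ({ω : BondConfig V | ∀ t ∈ insert x Y, ¬ (openGraph ω).Reachable d t} ∩ openConn d v)) :
    0 ≤ ∑ ω, weight (fun e => (q e : ℝ)) ω * (ind (avoidEv d (insert x Y)) ω *
        (cshPhi (fun e => (q e : ℝ)) x d Y g (openEdgeCluster ω d) * (ind (openConn d o : Set (BondConfig V)) ω - co))) -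
      p * ∑ ω, weight (fun e => (q e : ℝ)) ω * (ind (avoidEv d (insert x Y)) ω *
        (cshPhi (fun e => (q e : ℝ)) x d Y g (openEdgeCluster ω d) * (ind (openConn d v : Set (BondConfig V)) ω - cv))) := by
  set ŵ : Sym2 V → ℝ := fun e => (q e : ℝ) with hŵ
  have hw0 : ∀ e, 0 ≤ ŵ e := fun e => (q e).2.1
  have hw1 : ∀ e, ŵ e ≤ 1 := fun e => (q e).2.2
  set μ := prodBernoulli q with hμ
  set Φ : Set (Sym2 V) → ℝ := cshPhi ŵ x d Y g with hΦ
  have hΦm : Monotone Φ := cshPhi_mono ŵ hw0 hw1 x d Y g hg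
  set E₁ : Set (BondConfig V) := {ω : BondConfig V | ∀ t ∈ insert x Y, ¬ (openGraph ω).Reachable d t} with hE₁
  set A : Set (BondConfig V) := {ω : BondConfig V | ∀ t ∈ insert d (insert x Y), ¬ (openGraph ω).Reachable v t} with hA
  have hE₁av : avoidEv d (insert x Y) = E₁ := rfl
  rw [hE₁av, sum_ind_phi_eq, sum_ind_phi_eq]
  have key := CovTau.markerDominanceAvoid q d v o (insert x Y) hvd.symm Φ hΦm
  rw [← hμ] at key ⊢
  change μ.real (A ∩ openConn v o) * (μ.real E₁ * (∫ ω in E₁ ∩ openConn d v, Φ (openEdgeCluster ω d) ∂μ) -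
      (∫ ω in E₁, Φ (openEdgeCluster ω d) ∂μ) * μ.real (E₁ ∩ openConn d v)) ≤
    μ.real A * (μ.real E₁ * (∫ ω in E₁ ∩ openConn d o, Φ (openEdgeCluster ω d) ∂μ) -
      (∫ ω in E₁, Φ (openEdgeCluster ω d) ∂μ) * μ.real (E₁ ∩ openConn d o)) at key
  rw [← hp, ← hco, ← hcv] at key
  -- positivity of μ(A), μ(E₁)
  have posE : 0 < μ.real E₁ := by
    rw [hμ, measureReal_eq_sum]
    have hmem : (∅ : Set (Sym2 V)) ∈ E₁ := by
      intro t ht h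
      rw [reachable_empty_iff] at h
      rcases Set.mem_insert_iff.1 ht with rfl | ht
      · exact hdx h
      · exact hdY (h ▸ ht)
    calc 0 < weight ŵ (∅ : Set (Sym2 V)) * ind E₁ ∅ := by rw [ind_of_mem hmem, mul_one]; exact weight_empty_pos ŵ hq
      _ ≤ ∑ ω, weight ŵ ω * ind E₁ ω := Finset.single_le_sum (f := fun ω => weight ŵ ω * ind E₁ ω)
          (fun ω _ => mul_nonneg (weight_nonneg hw0 hw1 ω) (ind_nonneg _ _)) (Finset.mem_univ _)
  have posA : 0 < μ.real A := by
    rw [hμ, measureReal_eq_sum]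
    have hmem : (∅ : Set (Sym2 V)) ∈ A := by
      intro t ht h
      rw [reachable_empty_iff] at h
      rcases Set.mem_insert_iff.1 ht with rfl | ht
      · exact hvd h
      · rcases Set.mem_insert_iff.1 ht with rfl | ht
        · exact hvx h
        · exact hvY (h ▸ ht)
    calc 0 < weight ŵ (∅ : Set (Sym2 V)) * ind A ∅ := by rw [ind_of_mem hmem, mul_one]; exact weight_empty_pos ŵ hq
      _ ≤ ∑ ω, weight ŵ ω * ind A ω := Finset.single_le_sum (f := fun ω => weight ŵ ω * ind A ω)
          (fun ω _ => mul_nonneg (weight_nonneg hw0 hw1 ω) (ind_nonneg _ _)) (Finset.mem_univ _)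
  -- divide by μ(A) μ(E₁)
  set Io := ∫ ω in E₁ ∩ openConn d o, Φ (openEdgeCluster ω d) ∂μ with hIo
  set Iv := ∫ ω in E₁ ∩ openConn d v, Φ (openEdgeCluster ω d) ∂μ with hIv
  set I := ∫ ω in E₁, Φ (openEdgeCluster ω d) ∂μ with hI
  have key' : μ.real A * μ.real E₁ * (p * (Iv - cv * I)) ≤ μ.real A * μ.real E₁ * (Io - co * I) := by
    nlinarith [key]
  have hAE : 0 < μ.real A * μ.real E₁ := mul_pos posA posE
  have hfin : p * (Iv - cv * I) ≤ Io - co * I := le_of_mul_le_mul_left key' hAE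
  linarith

/-! ### The level-one cell -/

omit [Fintype V] in
/-- For `u ≠ x`: `1{∃ e ∈ C_x, u ∈ e} = 1{x ↔ u}`. [folklore] -/
theorem ind_exists_mem_openEdgeCluster (x u : V) (hux : u ≠ x) (η : Set (Sym2 V)) :
    ind {C : Set (Sym2 V) | ∃ e ∈ C, u ∈ e} (openEdgeCluster η x) = ind (openConn x u : Set (BondConfig V)) η := by
  by_cases h : (openGraph η).Reachable x u
  · rw [ind_of_mem (show η ∈ (openConn x u : Set (BondConfig V)) from h),
      ind_of_mem (show openEdgeCluster η x ∈ {C : Set (Sym2 V) | ∃ e ∈ C, u ∈ e} from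
        ((reachable_iff_exists_mem_openEdgeCluster η x u).1 h).resolve_left hux)]
  · rw [ind_of_not_mem (show η ∉ (openConn x u : Set (BondConfig V)) from h),
      ind_of_not_mem (show openEdgeCluster η x ∉ {C : Set (Sym2 V) | ∃ e ∈ C, u ∈ e} from
        fun hh => h ((reachable_iff_exists_mem_openEdgeCluster η x u).2 (Or.inr hh)))]

omit [Fintype V] in
/-- `{u ↔ {x, d}} = {x ↔ u} ∪ {d ↔ u}`. [folklore] -/
theorem setOf_exists_pair_reachable (x d u : V) :
    {ζ : BondConfig V | ∃ s ∈ ({x, d} : Set V), (openGraph ζ).Reachable s u} =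
      (openConn x u ∪ openConn d u : Set (BondConfig V)) := by
  ext ζ
  simp only [Set.mem_setOf_eq, Set.mem_insert_iff, Set.mem_singleton_iff, exists_eq_or_imp, exists_eq_left, Set.mem_union]
  rfl

/-- **The level-one cell of the conditioned slack hierarchy** (prim-hp-8's Theorem 1 at `k = 1`, CSH(`Y; x; (d); o, v`)[Ψ]),
modulo the diagonal A2/T_A inequality (Htw) taken as the hypothesis `HTW` (in `delE` form, for every monotone `g ≥ 0`):
for weights `< 1`, owner `x ∉ Y`, decoy `d ∉ {x} ∪ Y`, observers `o, v` off `{x, d}` (`v ∉ Y`), monotone `Ψ` on the open edge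
cluster of `x`, and constants `p = μ(v↔o | v ↮ x,d,Y)`, `c_u = μ(d↔u | d ↮ x,Y)`:
`0 ≤ μ(D)·∫_D Ψ(C_x)·h(C_x) − (∫_D Ψ(C_x))·(∫_D h(C_x))`, `D = {x ↮ Y}`, `h = 1_o − c_o 1_d − p(1_v − c_v 1_d)` (`1_u = 1{u ∈ C_x}`).
Proof: the reduction theorem (Lemma T, `BHK2006_clusterConditionalCov_nonneg_of_within`) + Lemma U (`lemmaU_one`) + H-part
(`hpart_nonneg`: world set-4PT + HTW) + K-part (`kpart_nonneg`: COV(τ) with avoided set `{x} ∪ Y` for `Φ`, monotone by Lemma Φ(b)).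
[cite: VandenbergHaggstromKahn2005, §2.1 pp. 10–13, Thms. 1.3–1.5 — corollaries] [cite: Gladkov2024, Thm. 3.2 — via `CovTau.ta_nonneg`] -/
theorem csh_one (q : Sym2 V → unitInterval) (hq : ∀ e, (q e : ℝ) < 1) (x d o v : V) (Y : Set V)
    (hdx : d ≠ x) (hdY : d ∉ Y) (hdo : d ≠ o) (hvd : v ≠ d) (hvx : v ≠ x) (hvY : v ∉ Y) (hox : o ≠ x)
    (Ψ : Set (Sym2 V) → ℝ) (hΨ : Monotone Ψ) (p co cv : ℝ)
    (hp : p * (prodBernoulli q).real {ω : BondConfig V | ∀ t ∈ insert d (insert x Y), ¬ (openGraph ω).Reachable v t} =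
      (prodBernoulli q).real ({ω : BondConfig V | ∀ t ∈ insert d (insert x Y), ¬ (openGraph ω).Reachable v t} ∩ openConn v o))
    (hco : co * (prodBernoulli q).real {ω : BondConfig V | ∀ t ∈ insert x Y, ¬ (openGraph ω).Reachable d t} =
      (prodBernoulli q).real ({ω : BondConfig V | ∀ t ∈ insert x Y, ¬ (openGraph ω).Reachable d t} ∩ openConn d o))
    (hcv : cv * (prodBernoulli q).real {ω : BondConfig V | ∀ t ∈ insert x Y, ¬ (openGraph ω).Reachable d t} =
      (prodBernoulli q).real ({ω : BondConfig V | ∀ t ∈ insert x Y, ¬ (openGraph ω).Reachable d t} ∩ openConn d v))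
    (HTW : ∀ g : Set (Sym2 V) → ℝ, Monotone g → (∀ C, 0 ≤ g C) →
      0 ≤ ∑ ω, weight (fun e => (q e : ℝ)) ω * (ind (avoidEv x Y) ω *
        ((delE (fun e => (q e : ℝ)) (cut Y ω)
              (ind ({ζ : BondConfig V | ∀ s ∈ ({x, d} : Set V), ¬ (openGraph ζ).Reachable s v} ∩ openConn o v)) /
            delE (fun e => (q e : ℝ)) (cut Y ω)
              (ind {ζ : BondConfig V | ∀ s ∈ ({x, d} : Set V), ¬ (openGraph ζ).Reachable s v}) - p) *
          covW (fun e => (q e : ℝ)) Y (fun η => g (openEdgeCluster η x))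
            (ind {ζ : BondConfig V | ∃ s ∈ ({x, d} : Set V), (openGraph ζ).Reachable s v}) ω))) :
    0 ≤ (prodBernoulli q).real {ω : BondConfig V | ∀ y ∈ Y, ¬ (openGraph ω).Reachable x y} *
        (∫ ω in {ω : BondConfig V | ∀ y ∈ Y, ¬ (openGraph ω).Reachable x y},
          Ψ (openEdgeCluster ω x) *
            (ind {C : Set (Sym2 V) | ∃ e ∈ C, o ∈ e} (openEdgeCluster ω x) -
              co * ind {C : Set (Sym2 V) | ∃ e ∈ C, d ∈ e} (openEdgeCluster ω x) -
              p * (ind {C : Set (Sym2 V) | ∃ e ∈ C, v ∈ e} (openEdgeCluster ω x) -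
                cv * ind {C : Set (Sym2 V) | ∃ e ∈ C, d ∈ e} (openEdgeCluster ω x))) ∂(prodBernoulli q)) -
      (∫ ω in {ω : BondConfig V | ∀ y ∈ Y, ¬ (openGraph ω).Reachable x y}, Ψ (openEdgeCluster ω x) ∂(prodBernoulli q)) *
        (∫ ω in {ω : BondConfig V | ∀ y ∈ Y, ¬ (openGraph ω).Reachable x y},
          (ind {C : Set (Sym2 V) | ∃ e ∈ C, o ∈ e} (openEdgeCluster ω x) -
              co * ind {C : Set (Sym2 V) | ∃ e ∈ C, d ∈ e} (openEdgeCluster ω x) -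
              p * (ind {C : Set (Sym2 V) | ∃ e ∈ C, v ∈ e} (openEdgeCluster ω x) -
                cv * ind {C : Set (Sym2 V) | ∃ e ∈ C, d ∈ e} (openEdgeCluster ω x))) ∂(prodBernoulli q)) := by
  set ŵ : Sym2 V → ℝ := fun e => (q e : ℝ) with hŵ
  have hw0 : ∀ e, 0 ≤ ŵ e := fun e => (q e).2.1
  have hw1 : ∀ e, ŵ e ≤ 1 := fun e => (q e).2.2
  have hm : ∑ ω, weight ŵ ω = 1 := by
    have h1 := integral_prodBernoulli_eq_sum q fun _ => (1 : ℝ)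
    simp only [integral_const, probReal_univ, smul_eq_mul, mul_one] at h1
    exact h1.symm
  -- the test function of the edge cluster
  set h : Set (Sym2 V) → ℝ := fun C => ind {C : Set (Sym2 V) | ∃ e ∈ C, o ∈ e} C -
      co * ind {C : Set (Sym2 V) | ∃ e ∈ C, d ∈ e} C -
      p * (ind {C : Set (Sym2 V) | ∃ e ∈ C, v ∈ e} C - cv * ind {C : Set (Sym2 V) | ∃ e ∈ C, d ∈ e} C) with hh
  have hX : ∀ e : Sym2 V, ¬ e.IsDiag → (∃ v ∈ e, v ∈ Y) → (q e : ℝ) < 1 := fun e _ _ => hq e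
  have main := BHK2006_clusterConditionalCov_nonneg_of_within q x Y hX h ?_ Ψ hΨ
  · simpa only [hh] using main
  -- the within hypothesis
  intro g hg hg0
  -- `h` read on the configuration
  have hread : ∀ η : Set (Sym2 V), h (openEdgeCluster η x) =
      ind (openConn x o : Set (BondConfig V)) η - co * ind (openConn x d : Set (BondConfig V)) η -
        p * (ind (openConn x v : Set (BondConfig V)) η - cv * ind (openConn x d : Set (BondConfig V)) η) := by
    intro η
    simp only [hh, ind_exists_mem_openEdgeCluster x o hox, ind_exists_mem_openEdgeCluster x d hdx,
      ind_exists_mem_openEdgeCluster x v hvx]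
  -- the integrand is the world covariance, the integral the world sum
  have hint : ∀ ω : Set (Sym2 V),
      (∫ η, g (openEdgeCluster (η \ {e | ∃ v ∈ e, ∃ x_1 ∈ Y, (openGraph ω).Reachable x_1 v}) x) *
            h (openEdgeCluster (η \ {e | ∃ v ∈ e, ∃ x_1 ∈ Y, (openGraph ω).Reachable x_1 v}) x) ∂(prodBernoulli q)) -
        (∫ η, g (openEdgeCluster (η \ {e | ∃ v ∈ e, ∃ x_1 ∈ Y, (openGraph ω).Reachable x_1 v}) x) ∂(prodBernoulli q)) *
        (∫ η, h (openEdgeCluster (η \ {e | ∃ v ∈ e, ∃ x_1 ∈ Y, (openGraph ω).Reachable x_1 v}) x) ∂(prodBernoulli q)) =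
      covW ŵ Y (fun η => g (openEdgeCluster η x)) (fun η => h (openEdgeCluster η x)) ω := by
    intro ω
    simp only [integral_prodBernoulli_eq_sum, covW, delE, cut]
    rfl
  have hsum : ∫ ω in {ω : BondConfig V | ∀ y ∈ Y, ¬ (openGraph ω).Reachable x y},
      ((∫ η, g (openEdgeCluster (η \ {e | ∃ v ∈ e, ∃ x_1 ∈ Y, (openGraph ω).Reachable x_1 v}) x) *
            h (openEdgeCluster (η \ {e | ∃ v ∈ e, ∃ x_1 ∈ Y, (openGraph ω).Reachable x_1 v}) x) ∂(prodBernoulli q)) -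
        (∫ η, g (openEdgeCluster (η \ {e | ∃ v ∈ e, ∃ x_1 ∈ Y, (openGraph ω).Reachable x_1 v}) x) ∂(prodBernoulli q)) *
        (∫ η, h (openEdgeCluster (η \ {e | ∃ v ∈ e, ∃ x_1 ∈ Y, (openGraph ω).Reachable x_1 v}) x) ∂(prodBernoulli q)))
        ∂(prodBernoulli q) =
      wsum ŵ x Y (fun η => g (openEdgeCluster η x)) (fun η => h (openEdgeCluster η x)) := by
    rw [setIntegral_eq_sum, wsum]
    refine Finset.sum_congr rfl fun ω _ => ?_
    rw [hint ω]; simp only [avoidEv]; ring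
  rw [hsum]
  -- linearity: wsum(g, h) = taB(o) − co taB(d) − p (taB(v) − cv taB(d))
  have hlin : wsum ŵ x Y (fun η => g (openEdgeCluster η x)) (fun η => h (openEdgeCluster η x)) =
      (taB ŵ x o Y g - co * taB ŵ x d Y g) - p * (taB ŵ x v Y g - cv * taB ŵ x d Y g) := by
    simp only [wsum, taB, Finset.mul_sum, ← Finset.sum_sub_distrib]
    refine Finset.sum_congr rfl fun ω _ => ?_
    rw [taC_eq_covW, taC_eq_covW, taC_eq_covW]
    rw [covW_congr ŵ Y (fun η => g (openEdgeCluster η x)) (fun η => hread η) ω]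
    have e1 := covW_add ŵ Y (fun η => g (openEdgeCluster η x))
      (fun η => ind (openConn x o : Set (BondConfig V)) η - co * ind (openConn x d : Set (BondConfig V)) η)
      (fun η => -p * (ind (openConn x v : Set (BondConfig V)) η - cv * ind (openConn x d : Set (BondConfig V)) η)) ω
    have e2 := covW_add ŵ Y (fun η => g (openEdgeCluster η x))
      (fun η => ind (openConn x o : Set (BondConfig V)) η) (fun η => -co * ind (openConn x d : Set (BondConfig V)) η) ω
    have e3 := covW_add ŵ Y (fun η => g (openEdgeCluster η x))
      (fun η => ind (openConn x v : Set (BondConfig V)) η) (fun η => -cv * ind (openConn x d : Set (BondConfig V)) η) ω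
    have e4 := covW_smul ŵ Y (fun η => g (openEdgeCluster η x)) (ind (openConn x d : Set (BondConfig V))) (-co) ω
    have e5 := covW_smul ŵ Y (fun η => g (openEdgeCluster η x)) (ind (openConn x d : Set (BondConfig V))) (-cv) ω
    have e6 := covW_smul ŵ Y (fun η => g (openEdgeCluster η x))
      (fun η => ind (openConn x v : Set (BondConfig V)) η - cv * ind (openConn x d : Set (BondConfig V)) η) (-p) ω
    have f1 : (fun η => ind (openConn x o : Set (BondConfig V)) η - co * ind (openConn x d : Set (BondConfig V)) η -
        p * (ind (openConn x v : Set (BondConfig V)) η - cv * ind (openConn x d : Set (BondConfig V)) η)) =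
        (fun η => (ind (openConn x o : Set (BondConfig V)) η - co * ind (openConn x d : Set (BondConfig V)) η) +
          -p * (ind (openConn x v : Set (BondConfig V)) η - cv * ind (openConn x d : Set (BondConfig V)) η)) := by
      funext η; ring
    have f2 : (fun η => ind (openConn x o : Set (BondConfig V)) η - co * ind (openConn x d : Set (BondConfig V)) η) =
        (fun η => ind (openConn x o : Set (BondConfig V)) η + -co * ind (openConn x d : Set (BondConfig V)) η) := by
      funext η; ring
    have f3 : (fun η => ind (openConn x v : Set (BondConfig V)) η - cv * ind (openConn x d : Set (BondConfig V)) η) =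
        (fun η => ind (openConn x v : Set (BondConfig V)) η + -cv * ind (openConn x d : Set (BondConfig V)) η) := by
      funext η; ring
    rw [f1, e1, f2, e2, e6, f3, e3]
    have g4 : covW ŵ Y (fun η => g (openEdgeCluster η x)) (fun η => -co * ind (openConn x d : Set (BondConfig V)) η) ω =
        -co * covW ŵ Y (fun η => g (openEdgeCluster η x)) (ind (openConn x d : Set (BondConfig V))) ω := e4
    have g5 : covW ŵ Y (fun η => g (openEdgeCluster η x)) (fun η => -cv * ind (openConn x d : Set (BondConfig V)) η) ω =
        -cv * covW ŵ Y (fun η => g (openEdgeCluster η x)) (ind (openConn x d : Set (BondConfig V))) ω := e5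
    rw [g4, g5]
    have g6 : covW ŵ Y (fun η => g (openEdgeCluster η x)) (fun η => ind (openConn x o : Set (BondConfig V)) η) ω =
        covW ŵ Y (fun η => g (openEdgeCluster η x)) (ind (openConn x o : Set (BondConfig V))) ω := rfl
    have g7 : covW ŵ Y (fun η => g (openEdgeCluster η x)) (fun η => ind (openConn x v : Set (BondConfig V)) η) ω =
        covW ŵ Y (fun η => g (openEdgeCluster η x)) (ind (openConn x v : Set (BondConfig V))) ω := rfl
    rw [g6, g7]; ring
  rw [hlin, lemmaU_one ŵ hm x d o Y g co hdx hdo, lemmaU_one ŵ hm x d v Y g cv hdx hvd.symm]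
  -- H-part and K-part
  have hH := hpart_nonneg q hq x d o v Y hvx hvd p g hg hg0 (HTW g hg hg0)
  rw [setOf_exists_pair_reachable x d o, setOf_exists_pair_reachable x d v] at hH
  have hK := kpart_nonneg q hq x d o v Y hvd hvx hvY hdx hdY g hg p co cv hp hco hcv
  have eo : wsum ŵ x Y (fun η => g (openEdgeCluster η x)) (ind (openConn x o ∪ openConn d o : Set (BondConfig V))) =
      wsum (fun e => (q e : ℝ)) x Y (fun η => g (openEdgeCluster η x)) (ind (openConn x o ∪ openConn d o : Set (BondConfig V))) := rfl
  linarith [hH, hK]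

end CSHCell

end HullPort

end Summit.CriticalPhenomena.PercolationContinuityZ3.Theorems
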